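import Summits.Ventures.PercRepro.Night2LocalD3OneOne
import Summits.Ventures.PercRepro.Night2LocalD3ThreeOneC

/-!
# PercRepro — **THE REGIME `|E ∖ G| = 3` AT `q = 4` IS CLOSED**: the `(6, 4)` shadow row modulo `|E ∖ G| = 2` (night-2, gen 13)

`localShadowHall_d3_k1`: for a loopless simple `M`, a rank-`5` flat `G` with `|E ∖ G| = 3` and exactly one coloop of `M|G`, the local
form (LI_G) holds — by the distance-2 rule, column by column: `a = 1` (`load2_le_cap2_one_one`), `a = 2` (`load2_le_cap2_two_one`),
`a = 3` (`load2_le_cap2_three_one`), `a = 4` (no layer-2 weight), `a ≥ 5` (no series pair).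

`localShadowHall_d3`: (LI_G) at EVERY rank-`5` flat with `|E ∖ G| = 3` of a loopless simple matroid, for every coloop count
(`k = 0`: `localShadowHall_d3_zero`; `k = 1`; `k = 2`: `localShadowHall_d3_k2`; `k ≥ 3`: `localShadowHall_of_card_le_kColoops`).

`shadowHall_six_four_of_local_two`: the `(6, 4)` shadow row for every finite matroid, modulo (LI_G) at the rank-`5` flats with
`|E ∖ G| = 2` and `kColoops ≤ 1` of loopless simple rank-`6` matroids.
-/

open scoped Matroid

namespace PercRepro.Shadow

open Finset PerFlat ThmH

variable {α : Type*} [DecidableEq α] {M : Matroid α} [M.Finite]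

section KOne

variable {G S : Finset α}

open scoped Classical in
/-- **THE CELL `kColoops = 1` OF `|E ∖ G| = 3` AT `q = 4`**: the local form (LI_G) holds. -/
theorem localShadowHall_d3_k1 (hs : ∀ e ∈ gr M, ∀ f ∈ gr M, e ≠ f → rkN M {e, f} = 2)
    (hl : ∀ e ∈ gr M, M.Indep {e}) (hG : G ∈ flatsQ M (4 + 1)) (hd : (gr M \ G).card = 3)
    (hk : kColoops M G = 1) : LocalShadowHall M 4 G := by
  apply localShadowHall_of_distance_two hG (by omega)
  intro S hS
  have hcap0 : 0 ≤ capS M 4 G S := capS_nonneg' hG (by omega) S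
  have ha1 : 1 ≤ (coloops M S).card := hk ▸ kColoops_le_card_coloops hS
  rcases Nat.lt_or_ge (coloops M S).card 2 with h2 | h2
  · exact load2_le_cap2_one_one hs hl hG hd hk hS (by omega)
  rcases Nat.lt_or_ge (coloops M S).card 3 with h3 | h3
  · exact load2_le_cap2_two_one hs hl hG hd hk hS (by omega)
  rcases Nat.lt_or_ge (coloops M S).card 4 with h4 | h4
  · exact load2_le_cap2_three_one hs hG hd hk hS (by omega)
  rcases Nat.lt_or_ge (coloops M S).card 5 with h5 | h5
  · rw [load2_eq_zero_of_ex2_eq_empty (ex2_eq_empty_of_card_coloops_eq_four hs hG hS (by omega))]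
    exact cap2_nonneg hcap0
  · rw [load2_eq_zero_of_ex2_eq_empty (ex2_eq_empty_of_five_le_card_coloops hG hS h5)]
    exact cap2_nonneg hcap0

open scoped Classical in
/-- **THE REGIME `|E ∖ G| = 3` AT `q = 4`**: (LI_G) holds at every rank-`5` flat with three points outside, for every coloop count. -/
theorem localShadowHall_d3 (hs : ∀ e ∈ gr M, ∀ f ∈ gr M, e ≠ f → rkN M {e, f} = 2)
    (hl : ∀ e ∈ gr M, M.Indep {e}) (hG : G ∈ flatsQ M (4 + 1)) (hd : (gr M \ G).card = 3) :
    LocalShadowHall M 4 G := by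
  rcases Nat.lt_or_ge (kColoops M G) 1 with h1 | h1
  · exact localShadowHall_d3_zero hs hl hG hd (by omega)
  rcases Nat.lt_or_ge (kColoops M G) 2 with h2 | h2
  · exact localShadowHall_d3_k1 hs hl hG hd (by omega)
  rcases Nat.lt_or_ge (kColoops M G) 3 with h3 | h3
  · exact localShadowHall_d3_k2 hs hl hG hd (by omega)
  · exact localShadowHall_of_card_le_kColoops hG hd (by norm_num) h3

end KOne

section SixFour

variable {α' : Type} [DecidableEq α']

/-- **THE `(6, 4)` SHADOW ROW FOR EVERY FINITE MATROID, MODULO `|E ∖ G| = 2` WITH `kColoops ≤ 1`** of loopless simple rank-`6`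
matroids. -/
theorem shadowHall_six_four_of_local_two
    (hloc2 : ∀ (N : Matroid α') [N.Finite], (∀ e ∈ gr N, ∀ f ∈ gr N, e ≠ f → rkN N {e, f} = 2) →
      (∀ e ∈ gr N, N.Indep {e}) → N.eRank = ((6 : ℕ) : ℕ∞) →
      ∀ G ∈ flatsQ N (4 + 1), (gr N \ G).card = 2 → kColoops N G ≤ 1 → LocalShadowHall N 4 G)
    (M : Matroid α') [M.Finite] : ShadowHall M 6 4 (phiK 6 4) := by
  apply shadowHall_six_four_of_local_k_le_one hloc2
  intro N _ hs hl _ G hG hd _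
  exact localShadowHall_d3 hs hl hG hd

end SixFour

end PercRepro.Shadow
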